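import Mathlib
import HarnessLib
import Summits.Ventures.LatticeQCDFlow.Scaling.WorkExponentialMomentsAnyGrid
import Summits.Ventures.LatticeQCDFlow.Scaling.PathWorkMoments

/-!
# GeneralLayerESSFloorAnyGrid — the `2τ̄`-form ESS floor along an ARBITRARY monotone grid with steps
# `≤ δ̄`: `ÊSS ≥ exp(−((1+θ)/(1−θ))·σ̄²·δ̄·(c_n − c_0))`, `θ = ρ·e^{3δ̄ΔD}` (the `t = 2` exponential
# moment of `Scaling/WorkExponentialMomentsAnyGrid`; the uniform grid is `Scaling/GeneralLayerESSFloorSharp`)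

HONEST FRAMING: exact (Metropolis-corrected) sampling algorithms for lattice gauge theory;
figures of merit are autocorrelation/cost numbers at stated couplings and volumes; no
continuum-physics claim.

Venture `LatticeQCDFlow` (cell pub-lqcd), topic `Scaling`; FANOUT row 19 (`su2-snf`, GEN-6).
OUR WORK, nothing cited as a fact.

* `inv_essFrac_path_eq_expMoment_two_grid` — `1/ÊSS = E_F[e^{−2(W − (F(c_n) − F(c_0)))}]` for the
  linear protocol along ANY grid `c` with positive layers leaving the Boltzmann weights invariant
  (instance of `Scaling/PathWorkMoments.inv_essFrac_path_eq_sum_exp_two`);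
* **`exp_le_ess_path_of_steps`** — positive unit-row-sum layers `χ²`-contracting towards their
  targets with `ρ ≥ 0` and leaving the weights invariant, `|D x − D y| ≤ ΔD`, `Var_c(D) ≤ σ̄²`
  (all `c`), grid steps `0 ≤ c_{k+1} − c_k ≤ δ̄`, `θ = ρe^{3δ̄ΔD} < 1`:
  `exp(−((1+θ)/(1−θ))·σ̄²·δ̄·(c_n − c_0)) ≤ ÊSS` — i.e. `−log ÊSS ≤ 2τ̄(θ)·σ̄²·δ̄·(c_n − c_0)`:
  at equal span the certificate depends on the schedule only through its LARGEST step.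

NOT CLAIMED: optimal schedules; any value of `ρ`, `σ̄`, `ΔD` for a lattice kernel.
-/

namespace Summit.Ventures.LatticeQCDFlow.Scaling

open Finset
open Literature.Probability.MarkovChains (IsRowStochastic IsStationary stepLaw)
open Summit.Ventures.LatticeQCDFlow.Exactness
open Summit.Ventures.LatticeQCDFlow.Theory2

variable {X : Type*} [Fintype X] [Nonempty X]

/-- **`1/ÊSS = E_F[e^{−2(W − ΔF)}]`** along any grid (`ΔF = F(c_n) − F(c_0)`), for positive layers
leaving the Boltzmann weights invariant. -/
theorem inv_essFrac_path_eq_expMoment_two_grid (S₀ D : X → ℝ) (c : ℕ → ℝ) (P : ℕ → X → X → ℝ)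
    (n : ℕ) (hPpos : ∀ k x y, 0 < P k x y)
    (hst : ∀ k, IsStationary (fun x => Real.exp (-(linAction S₀ D (c (k + 1)) x))) (P k)) :
    (essFrac (revPathLaw (fun k : Fin (n + 1) => linAction S₀ D (c k)) (fun k : Fin n => P k))
        (pathLaw (gibbsLaw (linAction S₀ D (c ((0 : Fin (n + 1)) : ℕ)))) (fun k : Fin n => P k)))⁻¹
      = ∑ ω : Fin (n + 1) → X,
          pathLaw (gibbsLaw (linAction S₀ D (c 0))) (fun k : Fin n => P k) ω
            * Real.exp (-(2 * (work (fun k : Fin (n + 1) => linAction S₀ D (c k)) ω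
                - (linFreeEnergy S₀ D (c n) - linFreeEnergy S₀ D (c 0))))) := by
  set S : Fin (n + 1) → X → ℝ := fun k => linAction S₀ D (c k) with hS
  have hP' : ∀ (k : Fin n) x y, 0 < (fun k : Fin n => P k) k x y := fun k x y => hPpos k x y
  have hst' : ∀ k : Fin n, IsStationary (fun x => Real.exp (-(S k.succ x)))
      ((fun k : Fin n => P k) k) := by
    intro k; simpa only [hS, Fin.val_succ] using hst k
  have h := inv_essFrac_path_eq_sum_exp_two S hP' hst'
  have hS0 : S 0 = linAction S₀ D (c ((0 : Fin (n + 1)) : ℕ)) := rfl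
  have hSlast : freeEnergy (S (Fin.last n)) = linFreeEnergy S₀ D (c n) := by
    rw [hS, linFreeEnergy]; simp only [Fin.val_last]
  have hS0' : freeEnergy (S 0) = linFreeEnergy S₀ D (c 0) := by rw [hS, linFreeEnergy]; simp
  have hS0'' : gibbsLaw (S 0) = gibbsLaw (linAction S₀ D (c 0)) := by rw [hS]; simp
  rw [← hS0, h, hSlast, hS0', hS0'']

/-- **THE ESS FLOOR ALONG A MONOTONE GRID WITH STEPS `≤ δ̄` (arbitrary layers).**
`exp(−((1+θ)/(1−θ))·σ̄²·δ̄·(c_n − c_0)) ≤ ÊSS`, `θ = ρ·e^{3δ̄ΔD} < 1`. -/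
theorem exp_le_ess_path_of_steps (S₀ D : X → ℝ) (c : ℕ → ℝ) (P : ℕ → X → X → ℝ) (n : ℕ)
    {ΔD ρ σbar δbar : ℝ} (hD : ∀ x y, |D x - D y| ≤ ΔD) (hPpos : ∀ k x y, 0 < P k x y)
    (hst : ∀ k, IsStationary (fun x => Real.exp (-(linAction S₀ D (c (k + 1)) x))) (P k))
    (hProw : ∀ k x, ∑ y, P k x y = 1)
    (hK : ∀ k, ChiSqContracts (P k) (gibbsLaw (linAction S₀ D (c (k + 1)))) ρ)
    (hρ : 0 ≤ ρ) (hσ0 : 0 ≤ σbar) (hσ : ∀ c', varD S₀ D c' ≤ σbar ^ 2)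
    (hmono : ∀ k, 0 ≤ c (k + 1) - c k) (hstep : ∀ k, c (k + 1) - c k ≤ δbar)
    (hθ1 : ρ * Real.exp (3 * δbar * ΔD) < 1) :
    Real.exp (-((1 + ρ * Real.exp (3 * δbar * ΔD)) / (1 - ρ * Real.exp (3 * δbar * ΔD))
        * σbar ^ 2 * δbar * (c n - c 0)))
      ≤ essFrac (revPathLaw (fun k : Fin (n + 1) => linAction S₀ D (c k)) (fun k : Fin n => P k))
          (pathLaw (gibbsLaw (linAction S₀ D (c ((0 : Fin (n + 1)) : ℕ)))) (fun k : Fin n => P k)) := by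
  -- the t = 2 exponential moment along the grid
  have h2 : (5 * |(2:ℝ)| + 2 * |(2:ℝ) - 1|) * δbar * ΔD / 4 = 3 * δbar * ΔD := by
    rw [show (2:ℝ) - 1 = 1 by norm_num, abs_of_pos (by norm_num : (0:ℝ) < 2), abs_one]; ring
  have hθ1' : ρ * Real.exp ((5 * |(2:ℝ)| + 2 * |(2:ℝ) - 1|) * δbar * ΔD / 4) < 1 := by rwa [h2]
  have hmgf := expMoment_work_le_of_steps 2 S₀ D c P n hD hPpos hProw hK hρ hσ0 hσ hmono hstep hθ1'
  rw [h2, show (2:ℝ) * (2 - 1) = 2 by norm_num, abs_of_pos (by norm_num : (0:ℝ) < 2),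
    max_eq_left (by norm_num : (0:ℝ) ≤ 2)] at hmgf
  rw [← inv_essFrac_path_eq_expMoment_two_grid S₀ D c P n hPpos hst] at hmgf
  have hst' : ∀ k : Fin n, IsStationary
      (fun x => Real.exp (-((fun k : Fin (n + 1) => linAction S₀ D (c k)) k.succ x)))
      ((fun k : Fin n => P k) k) := by
    intro k; simpa only [Fin.val_succ] using hst k
  have hE0 : 0 < essFrac (revPathLaw (fun k : Fin (n + 1) => linAction S₀ D (c k))
      (fun k : Fin n => P k))
      (pathLaw (gibbsLaw (linAction S₀ D (c ((0 : Fin (n + 1)) : ℕ)))) (fun k : Fin n => P k)) :=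
    essFrac_pos (pathLaw_pos (gibbsLaw_pos _) fun k x y => hPpos k x y) (sum_revPathLaw _ _ hst')
  rw [Real.exp_neg, inv_le_comm₀ (Real.exp_pos _) hE0]
  refine hmgf.trans (le_of_eq ?_)
  congr 1
  have h1θ : 1 - ρ * Real.exp (3 * δbar * ΔD) ≠ 0 := ne_of_gt (by linarith)
  field_simp
  ring

end Summit.Ventures.LatticeQCDFlow.Scaling
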